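import Literature.Topology.FourManifolds.BandCore
import Literature.Topology.FourManifolds.TubeSurgery
import Literature.Topology.FourManifolds.KirbyMovesStrictHandleSlide
import HarnessLib

/-!
# Normalising the band end: the band end in the coordinates of the tube of `Kⱼ`

Topic `Literature/Topology/FourManifolds`; fact seat `provefact-IsStrictHandleSlide.isSurgery`
(R. C. Kirby, *The Topology of 4-Manifolds*, LNM 1374 (1989), Ch. I §4, p. 10: the slide band
runs from `Kᵢ` to the framing push-off `Kⱼ' = ν (·, e₀)` of `Kⱼ`; remaining content in the tree:
the named fact (S) `Literature.Topology.FourManifolds.FramedLink.IsStrictHandleSlide.slideModel`,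
`KirbyMovesHandleSlide.lean`). To normalise the end of the band at `Kⱼ'` (make it flat and
radial in the tube `ν`) one reads the band map `band : ℝ² → S³` near its right edge `x₀ = 1` in
the coordinates `S¹ × ℝ²` of `ν`: the **normal coordinate of the band end**
`W x = (ν⁻¹ (band x)).2 ∈ ℝ²`. This file records its elementary properties (theorems only, no
named facts; `W` is used as an expression, not as a new definition):

* `Literature.Topology.FourManifolds.BandCore.isOpen_preimage_range_tube` — the set of
  parameters `x` with `band x ∈ ν (S¹ × ℝ²)` is open;
* `Literature.Topology.FourManifolds.BandCore.contMDiffOn_tubeNormal` — `W` is `C^∞` there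
  (composite of the band with the smooth inverse of the tube, `TubeNbhd.contMDiffOn_toHomeo_symm`);
* `Literature.Topology.FourManifolds.BandCore.tubeCoord_band_pt2_one`,
  `Literature.Topology.FourManifolds.BandCore.tubeNormal_band_pt2_one` — on the right edge,
  for heights `y ∈ [1/10, 9/10]`: `ν⁻¹ (band (1, y)) = (circlePt (thetaB y), e₀)`, in particular
  `W (1, y) = e₀` (`thetaB` is the right-edge lift of `BandCore.lean`, `band (1, y) = Kⱼ' (circlePt (thetaB y))`).

## References

* R. C. Kirby, *The Topology of 4-Manifolds*, LNM 1374, Springer (1989), Ch. I §4. [Kirby1989]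
-/

open scoped Manifold ContDiff Topology
open Function Set Metric

noncomputable section

namespace Literature.Topology.FourManifolds

namespace BandCore

variable [Knot.TubularNbhd.SmoothnessFacts] {A Kj : Knot} (ν : Knot.TubularNbhd Kj)
  {avoid : Set (Metric.sphere (0 : EuclideanSpace ℝ (Fin 4)) 1)} (b : BandCore A ν.pushOff avoid)

/-- **The parameters whose band point lies in the tube form an open set** (the tube has open
image and the band is continuous). [folklore] -/
theorem isOpen_preimage_range_tube : IsOpen (b.band ⁻¹' range ⇑ν) :=
  ν.toTubeNbhd.isOpen_range.preimage b.contMDiff.continuous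

/-- **The band end in tube coordinates is smooth**: `x ↦ ν⁻¹ (band x)` is `C^∞` on the open set
of parameters mapped into the tube. [folklore] -/
theorem contMDiffOn_tubeCoord :
    ContMDiffOn 𝓘(ℝ, EuclideanSpace ℝ (Fin 2)) ((𝓡 1).prod 𝓘(ℝ, EuclideanSpace ℝ (Fin 2))) ∞
      (fun x ↦ ν.toTubeNbhd.toHomeo.symm (b.band x)) (b.band ⁻¹' range ⇑ν) := by
  refine ν.toTubeNbhd.contMDiffOn_toHomeo_symm.comp b.contMDiff.contMDiffOn fun x hx ↦ ?_
  simpa using hx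

/-- **The normal coordinate of the band end is smooth** on the same open set. [folklore] -/
theorem contMDiffOn_tubeNormal :
    ContMDiffOn 𝓘(ℝ, EuclideanSpace ℝ (Fin 2)) 𝓘(ℝ, EuclideanSpace ℝ (Fin 2)) ∞
      (fun x ↦ (ν.toTubeNbhd.toHomeo.symm (b.band x)).2) (b.band ⁻¹' range ⇑ν) :=
  contMDiff_snd.comp_contMDiffOn (b.contMDiffOn_tubeCoord ν)

/-- **The right edge in tube coordinates**: for `y ∈ [1/10, 9/10]`,
`ν⁻¹ (band (1, y)) = (circlePt (thetaB y), e₀)` (`band (1, y) = Kⱼ' (circlePt (thetaB y))`,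
`Kⱼ' = ν (·, e₀)`). [folklore] -/
theorem tubeCoord_band_pt2_one {y : ℝ} (hy : y ∈ Icc (10⁻¹ : ℝ) (9 / 10)) :
    ν.toTubeNbhd.toHomeo.symm (b.band (pt2 1 y)) = (circlePt (b.thetaB y), framingBaseVector) := by
  rw [← b.apply_circlePt_thetaB hy, Knot.TubularNbhd.pushOff_apply]
  have h := ν.toTubeNbhd.toHomeo_symm_apply (circlePt (b.thetaB y), framingBaseVector)
  simpa using h

/-- The right edge of the band lies in the tube. [folklore] -/
theorem band_pt2_one_mem_range {y : ℝ} (hy : y ∈ Icc (10⁻¹ : ℝ) (9 / 10)) :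
    b.band (pt2 1 y) ∈ range ⇑ν := by
  rw [← b.apply_circlePt_thetaB hy, Knot.TubularNbhd.pushOff_apply]
  exact mem_range_self _

/-- **On the right edge the normal coordinate is `e₀`**: `W (1, y) = e₀` for `y ∈ [1/10, 9/10]`.
[folklore] -/
theorem tubeNormal_band_pt2_one {y : ℝ} (hy : y ∈ Icc (10⁻¹ : ℝ) (9 / 10)) :
    (ν.toTubeNbhd.toHomeo.symm (b.band (pt2 1 y))).2 = framingBaseVector := by
  rw [b.tubeCoord_band_pt2_one ν hy]

/-- **On the right edge the base coordinate is the push-off parameter**. [folklore] -/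
theorem tubeBase_band_pt2_one {y : ℝ} (hy : y ∈ Icc (10⁻¹ : ℝ) (9 / 10)) :
    (ν.toTubeNbhd.toHomeo.symm (b.band (pt2 1 y))).1 = circlePt (b.thetaB y) := by
  rw [b.tubeCoord_band_pt2_one ν hy]

end BandCore

end Literature.Topology.FourManifolds
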